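import Mathlib
import HarnessLib
import Literature.Analysis.FluidPDE.LagrangianLatticeCarrier
import Literature.Analysis.FluidPDE.PassiveVectorTensor
import Literature.Analysis.FluidPDE.PassiveVectorTensorFourier
import Literature.Analysis.FluidPDE.PassiveVectorTensorEnergyDecay
import Summits.AnomalousDissipation.AnomalousDissipation.Theorems.SolenoidalFractalHomogenisationLagrangianStepDefs
import Summits.AnomalousDissipation.AnomalousDissipation.Theorems.SolenoidalFractalHomogenisationLagrangianStepOneLevelDefs

/-!
# K1L `LagrangianRenormalisationStep` (stmt-AnomalousDissipation-24912) — crux idea `dissipation-metric-defect` (typed sketch)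

Planner `ad-ideate-p4` g5, lens «control» (controlling quantity), 2026-08-28.  Target: the LOAD-BEARING registered stub
`stub_oneLevelL` of the line `Cruxes/LagrangianRenormalisationStep/Lines/onelevel.lean` (two-sided DROP RATIO between consecutive
renormalised problems, for a.e. `t ∈ (1/2,1)`), whose recorded obstruction is: «the comparison must be proved RELATIVE TO THE DROP at the
level of dissipation integrals; an absolute `L∞L²` two-scale error divided by an a-priori drop is circular».

THE LEVER.  Never compare the STATES `u(t)`, `v(t)` in `L²`; compare the two problems in the *dissipation metric of the coarse problem*
restricted to the template's slow band `Λ_m = ⌊N_m ρ_m^{-1/8}⌋` (`ρ_m = N_m/N_{m+1}`):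

* controlling quantity (D2): the CUMULATIVE BAND-LIMITED DISSIPATION-METRIC DEFECT
  `Q(t) = ∫_{(0,t]} 4π² Σ_{|k| ≤ Λ_m} Re⟪(û−v̂)(s,k), T_{A_v}(k)(û−v̂)(s,k)⟫ ds`, `A_v = kbar_m · renormStep Φ g S`,
  claimed `≤ (Cρ^σ)² ×` (slow-band `A_v`-dissipation of `v`) — it is produced by the energy inequality for `e = P_Λ u − v` with the
  COERCIVITY OF `v` (`kbar_m`, not `kbar_{m+1}`) and a forcing measured in the dual dissipation norm `L²_t H⁻¹_{A_v}` RELATIVE to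
  `‖A_v^{1/2}∇P_Λ u‖_{L²_{t,x}}` (band-limitation replaces Armstrong–Vicol's analyticity ladder: `‖∇²P_Λ u‖ ≤ 2πΛ‖∇P_Λ u‖`);
* controlling identity (D3): `drop(u,t) ≈ 2∫ slow-band A_v-dissipation of u` relatively (the off-band = corrector dissipation of `u` IS the
  Taylor increment `kbar_{m+1} g ⟨ΦS ∇P_Λu, ∇P_Λu⟩` up to a SLAVED corrector defect — the centre-manifold/hypocoercivity control of
  Beck–Chaudhary–Wayne and Coti Zelati–Gallay, used for slaving rather than for decay rates);
* (D4): `v`'s off-band dissipation is relatively small (datum junk carries `Λ_m^{-2}`, carrier commutator carries `ρ^{1/8}`).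

Then the drop ratio is PURE ALGEBRA (Cauchy–Schwarz in the dissipation inner product, `§1` below, kernel-checked): no a-priori drop floor, no
window counting in `L²`, no division.  `§2` types the controlling quantities over the tree's vocabulary (`symbT`, `freqBall`, `drop`, `TSol`,
`renormStep`), `§3` the three defect predicates and the route-level target `DefectRoute`.  Definitions and elementary real lemmas only —
NOT a proof of the stub, of K1L, or of anomalous dissipation.
-/

set_option linter.dupNamespace false
set_option linter.unusedVariables false

namespace Summit.AnomalousDissipation.AnomalousDissipation.Cruxes.LagrangianRenormalisationStep.DissipationMetricDefect

open Literature.Analysis Literature.Analysis.FluidPDE Literature.Analysis.FunctionSpaces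
open MeasureTheory Set Filter UnitAddTorus
open scoped ENNReal NNReal InnerProductSpace
open Summit.AnomalousDissipation.AnomalousDissipation.Theorems.SolenoidalFractalHomogenisation.LagrangianStep

noncomputable section

/-! ## §1 Conversion lemmas (PROVED): dissipation-metric closeness ⇒ two-sided ratio, with no floor -/

/-- Cauchy–Schwarz form of the energy comparison: `|‖x‖² − ‖y‖²| ≤ ‖x − y‖ (‖x‖ + ‖y‖)` in any seminormed group
(applied in `L²_t L²_x` with `x = A_v^{1/2} ∇P_Λ u`, `y = A_v^{1/2} ∇v`: the difference is the defect `Q^{1/2}`, RELATIVE by (D2)). -/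
theorem abs_sq_norm_sub_sq_norm_le {F : Type*} [SeminormedAddCommGroup F] (x y : F) :
    |‖x‖ ^ 2 - ‖y‖ ^ 2| ≤ ‖x - y‖ * (‖x‖ + ‖y‖) := by
  have h1 : ‖x‖ ^ 2 - ‖y‖ ^ 2 = (‖x‖ - ‖y‖) * (‖x‖ + ‖y‖) := by ring
  rw [h1, abs_mul, abs_of_nonneg (by positivity : 0 ≤ ‖x‖ + ‖y‖)]
  exact mul_le_mul_of_nonneg_right (abs_norm_sub_norm_le x y) (by positivity)

/-- Relative closeness in a (semi)norm squares to a two-sided window: `‖x − y‖ ≤ ε‖y‖`, `0 ≤ ε ≤ 1` ⇒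
`(1 − 2ε)‖y‖² ≤ ‖x‖² ≤ (1 + 3ε)‖y‖²`. -/
theorem sq_norm_window_of_norm_sub_le {F : Type*} [SeminormedAddCommGroup F] {x y : F} {ε : ℝ}
    (hε : 0 ≤ ε) (hε1 : ε ≤ 1) (h : ‖x - y‖ ≤ ε * ‖y‖) :
    (1 - 2 * ε) * ‖y‖ ^ 2 ≤ ‖x‖ ^ 2 ∧ ‖x‖ ^ 2 ≤ (1 + 3 * ε) * ‖y‖ ^ 2 := by
  have hy : 0 ≤ ‖y‖ := norm_nonneg y
  have hx : 0 ≤ ‖x‖ := norm_nonneg x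
  have hlow : (1 - ε) * ‖y‖ ≤ ‖x‖ := by
    have := norm_sub_norm_le y x
    rw [norm_sub_rev] at this
    linarith
  have hup : ‖x‖ ≤ (1 + ε) * ‖y‖ := by
    have := norm_sub_norm_le x y
    linarith
  have h0 : 0 ≤ (1 - ε) * ‖y‖ := mul_nonneg (by linarith) hy
  have hl2 : ((1 - ε) * ‖y‖) ^ 2 ≤ ‖x‖ ^ 2 := pow_le_pow_left₀ h0 hlow 2
  have hu2 : ‖x‖ ^ 2 ≤ ((1 + ε) * ‖y‖) ^ 2 := pow_le_pow_left₀ hx hup 2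
  constructor
  · nlinarith [sq_nonneg ε, sq_nonneg ‖y‖, mul_nonneg (sq_nonneg ε) (sq_nonneg ‖y‖)]
  · have : ε ^ 2 ≤ ε := by nlinarith
    nlinarith [sq_nonneg ‖y‖, mul_nonneg (sub_nonneg.2 this) (sq_nonneg ‖y‖)]

/-- The same for nonnegative reals through square roots (dissipation integrals are squares of `L²_{t,x}` norms):
`|√a − √c| ≤ ε√c` ⇒ `(1 − 2ε)c ≤ a ≤ (1 + 3ε)c`. -/
theorem window_of_sqrt_sub_le {a c ε : ℝ} (ha : 0 ≤ a) (hc : 0 ≤ c) (hε : 0 ≤ ε) (hε1 : ε ≤ 1)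
    (h : |Real.sqrt a - Real.sqrt c| ≤ ε * Real.sqrt c) :
    (1 - 2 * ε) * c ≤ a ∧ a ≤ (1 + 3 * ε) * c := by
  have h' : ‖Real.sqrt a - Real.sqrt c‖ ≤ ε * ‖Real.sqrt c‖ := by
    simpa [Real.norm_eq_abs, abs_of_nonneg (Real.sqrt_nonneg c)] using h
  have key := sq_norm_window_of_norm_sub_le (F := ℝ) hε hε1 h'
  simpa [Real.norm_eq_abs, sq_abs, Real.sq_sqrt ha, Real.sq_sqrt hc] using key

/-- **The one-level ratio from the three relative defects (numeric core of the idea).**  With `Du = drop(u,t)`, `Dv = drop(v,t)`,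
`a` = twice the slow-band `A_v`-dissipation of `u`, `c` = the same of `v`:
(D2) `|√a − √c| ≤ ε√c` (dissipation-metric defect, after Cauchy–Schwarz in the `A_v`-form), (D3) `|Du − a| ≤ ε·Dv`, (D4) `|Dv − c| ≤ ε·Dv`
⇒ `(1 − 8ε)Dv ≤ Du ≤ (1 + 8ε)Dv` — exactly the shape of `stub_oneLevelL`'s conclusion with `C₁ρ^σ₁ = 8ε`.  No lower bound on `Dv` is used. -/
theorem ratio_of_defects {Du Dv a c ε : ℝ} (hε : 0 ≤ ε) (hε1 : ε ≤ 1) (ha : 0 ≤ a) (hc : 0 ≤ c) (hDv : 0 ≤ Dv)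
    (h2 : |Real.sqrt a - Real.sqrt c| ≤ ε * Real.sqrt c) (h3 : |Du - a| ≤ ε * Dv) (h4 : |Dv - c| ≤ ε * Dv) :
    (1 - 8 * ε) * Dv ≤ Du ∧ Du ≤ (1 + 8 * ε) * Dv := by
  obtain ⟨hlo, hhi⟩ := window_of_sqrt_sub_le ha hc hε hε1 h2
  obtain ⟨h3a, h3b⟩ := abs_le.1 h3
  obtain ⟨h4a, h4b⟩ := abs_le.1 h4
  constructor
  · -- lower: a ≥ (1-2ε)c, c ≥ (1-ε)Dv when helpful; handle the sign of (1-2ε) via nlinarith products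
    nlinarith [mul_nonneg hε hDv, mul_nonneg hε hc, mul_nonneg (mul_nonneg hε hε) hDv]
  · nlinarith [mul_nonneg hε hDv, mul_nonneg hε hc, mul_nonneg (mul_nonneg hε hε) hDv]

/-! ## §2 The controlling quantities, typed over the tree's vocabulary -/

/-- Band-limited symbol DISSIPATION density of one field at time `s`: `4π² Σ_{|k| ≤ N} Re⟪û(s)(k), T_𝔸(k) û(s)(k)⟫`
(the summand of the tree's energy identity `ae_tendsto_setIntegral_symbForm`, truncated at the band `N`). -/
def symbDiss (𝔸 : Torus.Visc4 (Fin 3)) (N : ℕ) (u : ℝ → VF) (s : ℝ) : ℝ :=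
  4 * Real.pi ^ 2 * ∑ k ∈ FunctionSpaces.Torus.freqBall N,
    (⟪mFourierCoeff (FunctionSpaces.EuclideanSpace.complexify ∘ u s) k,
      Torus.symbT 𝔸 k (mFourierCoeff (FunctionSpaces.EuclideanSpace.complexify ∘ u s) k)⟫_ℂ).re

/-- Band-limited symbol DEFECT density: the same form on the difference field `u(s) − v(s)`. -/
def symbDefect (𝔸 : Torus.Visc4 (Fin 3)) (N : ℕ) (u v : ℝ → VF) (s : ℝ) : ℝ :=
  symbDiss 𝔸 N (fun r x => u r x - v r x) s

/-- Cumulative band-limited dissipation `∫_{(0,t]} symbDiss`. -/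
def cumDiss (𝔸 : Torus.Visc4 (Fin 3)) (N : ℕ) (u : ℝ → VF) (t : ℝ) : ℝ :=
  ∫ s in Ioc 0 t, symbDiss 𝔸 N u s

/-- THE CONTROLLING QUANTITY `Q(t)`: cumulative band-limited dissipation-metric defect `∫_{(0,t]} symbDefect`. -/
def cumDefect (𝔸 : Torus.Visc4 (Fin 3)) (N : ℕ) (u v : ℝ → VF) (t : ℝ) : ℝ :=
  ∫ s in Ioc 0 t, symbDefect 𝔸 N u v s

/-- The template's scale ratio `ρ_m = N_m / N_{m+1}`. -/
def ratioN {k : ℕ} (E : LatticeShear.LagrangianLatticeCarrier k) (m : ℕ) : ℝ :=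
  (E.N m : ℝ) / E.N (m + 1)

/-- The template's slow band `Λ_m = ⌊N_m ρ_m^{-1/8}⌋` (template clause (T3): slow modes `|ℓ|⌈K/ν⌉ ≤ n`). -/
def slowBand {k : ℕ} (E : LatticeShear.LagrangianLatticeCarrier k) (m : ℕ) : ℕ :=
  ⌊(E.N m : ℝ) * (((E.N (m + 1) : ℝ) / E.N m) ^ (1 / 8 : ℝ))⌋₊

/-- The renormalised (coarse) tensor of level `m` for the window shape `S`: `A_v = kbar_m · renormStep Φ g_{m+1} S`. -/
def coarseTensor {k : ℕ} (E : LatticeShear.LagrangianLatticeCarrier k) (Φ : Torus.Visc4 (Fin 3) → Torus.Visc4 (Fin 3))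
    (m : ℕ) (S : Torus.Visc4 (Fin 3)) : Torus.Visc4 (Fin 3) :=
  E.kbar m • renormStep Φ (E.gain / E.cellVisc (m + 1) ^ 2) S

/-! ## §3 The three relative defect predicates and the route-level target -/

/-- (D2) RELATIVE SLOW DEFECT: the cumulative slow-band defect in the `A_v`-metric is `≤ (C ρ_m^σ)²/2 ×` twice the slow-band
`A_v`-dissipation of `v` — for a.e. `t ∈ (0,1)`.  (Energy inequality for `P_Λ u − v` with `v`'s coercivity; forcing = slow-band flux of
the slaved corrector defect + carrier/band commutator + distortion, each relative in `L²_t H⁻¹_{A_v}`.) -/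
def SlowDefectAt {k : ℕ} (E : LatticeShear.LagrangianLatticeCarrier k) (Φ : Torus.Visc4 (Fin 3) → Torus.Visc4 (Fin 3))
    (m : ℕ) (S : Torus.Visc4 (Fin 3)) (u v : ℝ → VF) (C σ : ℝ) : Prop :=
  ∀ᵐ t ∂(volume.restrict (Ioo (0:ℝ) 1)),
    2 * cumDefect (coarseTensor E Φ m S) (slowBand E m) u v t
      ≤ (C * ratioN E m ^ σ) ^ 2 * (2 * cumDiss (coarseTensor E Φ m S) (slowBand E m) v t)

/-- (D3) CONTROLLING IDENTITY FOR `u`: the total drop of the FINE problem equals twice the slow-band dissipation of `u` in the COARSE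
metric, relatively — the off-band (corrector) dissipation of `u` is the Taylor increment of its slow part up to the slaved defect. -/
def RenormalisedDropAt {k : ℕ} (E : LatticeShear.LagrangianLatticeCarrier k) (Φ : Torus.Visc4 (Fin 3) → Torus.Visc4 (Fin 3))
    (m : ℕ) (S : Torus.Visc4 (Fin 3)) (w₀ : VF) (u v : ℝ → VF) (C σ : ℝ) : Prop :=
  ∀ᵐ t ∂(volume.restrict (Ioo (1/2:ℝ) 1)),
    |drop w₀ u t - 2 * cumDiss (coarseTensor E Φ m S) (slowBand E m) u t| ≤ C * ratioN E m ^ σ * drop w₀ v t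

/-- (D4) OFF-BAND SMALLNESS FOR `v`: the coarse problem's drop is its slow-band dissipation, relatively (datum junk above `Λ_m` carries
`R/Λ_m²`, the coarse carrier's band commutator carries `ρ^{1/8}`). -/
def SlowDropAt {k : ℕ} (E : LatticeShear.LagrangianLatticeCarrier k) (Φ : Torus.Visc4 (Fin 3) → Torus.Visc4 (Fin 3))
    (m : ℕ) (S : Torus.Visc4 (Fin 3)) (w₀ : VF) (v : ℝ → VF) (C σ : ℝ) : Prop :=
  ∀ᵐ t ∂(volume.restrict (Ioo (1/2:ℝ) 1)),
    |drop w₀ v t - 2 * cumDiss (coarseTensor E Φ m S) (slowBand E m) v t| ≤ C * ratioN E m ^ σ * drop w₀ v t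

/-- The conclusion of `stub_oneLevelL` at fixed data (its comparison conjunct). -/
def OneLevelRatioAt {k : ℕ} (E : LatticeShear.LagrangianLatticeCarrier k) (m : ℕ) (w₀ : VF) (u v : ℝ → VF) (C₁ σ₁ : ℝ) : Prop :=
  ∀ᵐ t ∂(volume.restrict (Ioo (1/2 : ℝ) 1)),
    (1 - C₁ * ratioN E m ^ σ₁) * drop w₀ v t ≤ drop w₀ u t ∧ drop w₀ u t ≤ (1 + C₁ * ratioN E m ^ σ₁) * drop w₀ v t

/-- **ROUTE-LEVEL TARGET of the idea** (the `C⁺` the line would prove in place of a state comparison): under the re-cut cell package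
(`WindowClause` / `SlowVectorClause` / `CellEnergyClauses`, binders copied from the registered `stub_oneLevelL`) there are template
constants such that for every carrier `E` on the template, every class `R`, all deep levels `m ≥ m⋆`, every window shape `S`, every
class-`R` datum and EVERY pair of weak solutions (fine level `m+1` / renormalised level `m`), the three relative defects (D2)–(D4) hold
with ONE pair `(C, σ)`.  `ratio_of_defects` + positivity of the symbol form then give `OneLevelRatioAt E m w₀ u v (8C) σ` (for `Cρ^σ ≤ 1`). -/
def DefectRoute : Prop :=
  ∀ k (W : LatticeShear.LatticeWord k) (M : ℝ) (hM : 0 < M) (c : ℝ), 0 < c →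
    ∀ (Φ : Torus.Visc4 (Fin 3) → Torus.Visc4 (Fin 3)) (lo hi Λ β σ C ν₀ K Cf νf Kf : ℝ),
      0 < lo → lo ≤ 1 → 1 ≤ hi → 1 < Λ → 0 ≤ β → WindowClause Φ lo hi Λ β →
      0 < σ → 0 ≤ C → 0 < ν₀ → 0 < K → SlowVectorClause W M hM c Φ lo hi Λ β σ C ν₀ K →
      0 ≤ Cf → 0 < νf → 0 < Kf → CellEnergyClauses W M hM c lo hi Λ β Cf νf Kf →
      ∃ ν₁ > (0:ℝ), ∃ K₁ > (0:ℝ), ∃ Λ₀ : ℕ, ∃ θ₀ > (0:ℝ), ∃ C' > (0:ℝ), ∃ σ' > (0:ℝ),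
        ∀ E : LatticeShear.LagrangianLatticeCarrier k, E.design = W.stretch M hM → E.gain = c → E.nu0 = ν₁ → E.K = K₁ →
          E.LPermissible → E.Regular → (∀ m, Λ₀ * E.N m ≤ E.N (m + 1)) → (∀ m, E.N m ^ 2 ≤ E.N (m + 1)) →
          (∀ m, E.cellVisc (m + 1) * ((E.N (m + 1) : ℝ) / E.N m) ^ (1 / 4 : ℝ) ≤ 1) →
          (∀ m, E.K * ((E.N (m + 1) : ℝ) / E.N m) ^ (1 / 4 : ℝ) ≤ ((E.N (m + 1) : ℝ) / E.N m) * E.cellVisc (m + 1)) →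
          (∀ m, E.θ (m + 1) * ((E.N (m + 1) : ℝ) / E.N m) ^ (1 / 16 : ℝ) ≤ θ₀) →
          (∀ m, ((E.N (m + 1) : ℝ) / E.N m) ^ (1 / 16 : ℝ) * E.physPeriod (m + 1) ≤ E.refresh (m + 1)) →
        ∀ R : ℝ≥0, ∃ mstar : ℕ, ∀ m, mstar ≤ m →
          ∀ S : Torus.Visc4 (Fin 3), Torus.OddSmall S β → Torus.NearIso S lo hi →
          ∀ (w₀ : VF), IsDatum w₀ → InClass R w₀ →
          ∀ u v : ℝ → VF, TSol E (m + 1) (E.kbar (m + 1) • S) w₀ u → TSol E m (coarseTensor E Φ m S) w₀ v →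
            SlowDefectAt E Φ m S u v C' σ' ∧ RenormalisedDropAt E Φ m S w₀ u v C' σ' ∧ SlowDropAt E Φ m S w₀ v C' σ'

/-- FIRST LEMMA of the line (typed, the cheapest genuinely-PDE statement): (D4) alone — the renormalised problem's drop is carried by the
slow band, relatively — from the tensor energy identity (E5), the class bound `InClass R` (datum energy above `Λ_m` is `≤ R/(4π²Λ_m²)·E₀`)
and the smoothness of the coarse carrier at the band scale. -/
def FirstLemma : Prop :=
  ∀ k (W : LatticeShear.LatticeWord k) (M : ℝ) (hM : 0 < M) (c : ℝ), 0 < c →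
    ∀ (Φ : Torus.Visc4 (Fin 3) → Torus.Visc4 (Fin 3)) (lo hi Λ β : ℝ), 0 < lo → lo ≤ 1 → 1 ≤ hi → 1 < Λ → 0 ≤ β →
      WindowClause Φ lo hi Λ β →
      ∃ Λ₀ : ℕ, ∃ θ₀ > (0:ℝ), ∃ C' > (0:ℝ), ∃ σ' > (0:ℝ),
        ∀ E : LatticeShear.LagrangianLatticeCarrier k, E.design = W.stretch M hM → E.gain = c →
          E.LPermissible → E.Regular → (∀ m, Λ₀ * E.N m ≤ E.N (m + 1)) → (∀ m, E.N m ^ 2 ≤ E.N (m + 1)) →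
          (∀ m, E.θ (m + 1) * ((E.N (m + 1) : ℝ) / E.N m) ^ (1 / 16 : ℝ) ≤ θ₀) →
        ∀ R : ℝ≥0, ∃ mstar : ℕ, ∀ m, mstar ≤ m →
          ∀ S : Torus.Visc4 (Fin 3), Torus.OddSmall S β → Torus.NearIso S lo hi →
          ∀ (w₀ : VF), IsDatum w₀ → InClass R w₀ →
          ∀ v : ℝ → VF, TSol E m (coarseTensor E Φ m S) w₀ v → SlowDropAt E Φ m S w₀ v C' σ'

/-- Sanity glue (PROVED): at a fixed time, the three defect inequalities in the shape produced by (D2)–(D4) yield the two-sided window of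
`stub_oneLevelL` — `ratio_of_defects` read with `ε = C ρ^σ ≤ 1`. -/
theorem oneLevel_window_at {Du Dv a c Cρσ : ℝ} (h0 : 0 ≤ Cρσ) (h1 : Cρσ ≤ 1) (ha : 0 ≤ a) (hc : 0 ≤ c) (hDv : 0 ≤ Dv)
    (h2 : |Real.sqrt a - Real.sqrt c| ≤ Cρσ * Real.sqrt c) (h3 : |Du - a| ≤ Cρσ * Dv) (h4 : |Dv - c| ≤ Cρσ * Dv) :
    (1 - 8 * Cρσ) * Dv ≤ Du ∧ Du ≤ (1 + 8 * Cρσ) * Dv :=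
  ratio_of_defects h0 h1 ha hc hDv h2 h3 h4

end

end Summit.AnomalousDissipation.AnomalousDissipation.Cruxes.LagrangianRenormalisationStep.DissipationMetricDefect
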